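import Mathlib.MeasureTheory.Measure.Lebesgue.Basic
import Mathlib.MeasureTheory.Integral.Prod
import Mathlib.MeasureTheory.Integral.DominatedConvergence
import Literature.Analysis.FunctionSpaces.SobolevTraceGraph
import Literature.Analysis.FunctionSpaces.SobolevDomainProofs
import HarnessLib

/-!
# The `L^p` estimate of Stein's extension operator: vertical averages below a Lipschitz graph

E. M. Stein, *Singular Integrals and Differentiability Properties of Functions* (1970), Ch. VI,
§3.2.3, the `L^p` part of the proof of Theorem 5': after the pointwise estimates, every
derivative of `𝔈(f)` at a point `(x, y)` below the graph `y = φ(x)` of a special Lipschitz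
domain is bounded by averages `δ⁻¹ ∫_δ^{cδ} |∂^α f(x, y + s)| ds` over the vertical segment
above it (`δ ≈ φ(x) - y` the depth), and "Hardy's inequality (see Appendix A, p. 272) then
shows" the `L^p` inequalities, applied on every vertical line (Stein, (27)–(28)), the
variables `x` being integrated out by Fubini. This file proves that step on a
finite-dimensional real inner product space `E'` with unit direction `u`, for an *abstract depth
function* `d : E' → ℝ` subject only to continuity and the flow property `d (z + t u) = d z - t`
(the region below the graph is `{d > 0}`, the domain is `{d < 0}`); the depth of the special
Lipschitz domain `{y | γ (y - ⟪y, u⟫ u) < ⟪y, u⟫}` is `d = -LipGraph.height u γ`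
(`SobolevTraceGraph`), for which the flow property and the Lipschitz bound `M + 1` are recorded
here as complements to the `LipGraph` API (`LipGraph.height_add_smul`,
`LipGraph.lipschitzWith_height`, `LipGraph.setOf_height_pos`):

* the **one-dimensional inequality** (`Literature.Analysis.FunctionSpaces.setLIntegral_Iio_lintegral_Ioc_le`): for `V ≥ 0`,
  `∫_{y < y₀} ∫_{σ ∈ (2, a]} V(y + σ (y₀ - y)) dσ dy ≤ (a - 2) ∫_{y > y₀} V` — for each `σ` the
  map `y ↦ y + σ (y₀ - y)` is affine with slope `1 - σ ≤ -1` from `{y < y₀}` onto `{y > y₀}`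
  (this replaces Hardy's inequality: the averages here run over `[2δ, 2aδ]`, away from `0`);
* the vertical slicing of an additive Haar measure, `∫ Φ dμ = c ∫_{uᗮ} ∫_ℝ Φ(x + t u) dt`, is
  the case `γ = 0` of `LipGraph.lintegral_hypMeasure_lintegral_line` (`SobolevTraceGraph`);
  with it, the graph `{d = 0}` is `μ`-null (`Literature.Analysis.FunctionSpaces.measure_setOf_depth_eq_zero`) and the
  one-dimensional inequality integrates to the bound on `E'` (`Literature.Analysis.FunctionSpaces.setLIntegral_lineAvg_le`):
  `∫_{d > 0} ∫_{σ ∈ (2,a]} V(z + σ d(z) u) dσ dμ ≤ (a - 2) ∫_{d < 0} V dμ`, and its `L^p` form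
  for the averages `z ↦ ∫₂^a ‖H(z + σ d(z) u)‖ dσ` of a continuous `H`
  (`Literature.Analysis.FunctionSpaces.eLpNorm_lineNormAvg_le`, constant `a - 2`, uniform in `1 ≤ p < ∞`; Jensen's inequality
  on `(2, a]`).

## References

* E. M. Stein, *Singular Integrals and Differentiability Properties of Functions*, Princeton
  Math. Series 30 (1970), Ch. VI, §3.2.3, (27)–(28); Appendix A.4 (Hardy's inequality).
-/

noncomputable section

open MeasureTheory TopologicalSpace Filter Set Metric Function intervalIntegral
open scoped ENNReal NNReal Topology InnerProductSpace

namespace Literature.Analysis.FunctionSpaces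

/-! ### Complements on `LipGraph.height` -/

namespace LipGraph

variable {E' : Type*} [NormedAddCommGroup E'] [InnerProductSpace ℝ E']

/-- **Flow property of the height**: moving by `t` in the direction `u` increases the height
above the graph by `t`. [folklore] -/
theorem height_add_smul {u : E'} (hu : ‖u‖ = 1) (γ : E' → ℝ) (z : E') (t : ℝ) :
    height u γ (z + t • u) = height u γ z + t := by
  rw [height, height, proj_add_smul hu, inner_add_left, real_inner_smul_left,
    real_inner_self_eq_norm_sq, hu]
  ring

/-- The height above the graph of an `M`-Lipschitz function is `(M + 1)`-Lipschitz
(`|⟪z - z', u⟫| ≤ ‖z - z'‖` and `‖proj u (z - z')‖ ≤ ‖z - z'‖`). [folklore] -/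
theorem lipschitzWith_height {u : E'} (hu : ‖u‖ = 1) {γ : E' → ℝ} {M : ℝ≥0}
    (hγ : LipschitzWith M γ) : LipschitzWith (M + 1) (height u γ) := by
  refine LipschitzWith.of_dist_le_mul fun z z' => ?_
  have h1 : dist (γ (proj u z)) (γ (proj u z')) ≤ M * ‖z - z'‖ :=
    (hγ.dist_le_mul _ _).trans (mul_le_mul_of_nonneg_left
      (by rw [dist_eq_norm, proj_sub]; exact norm_proj_le hu _) M.coe_nonneg)
  have h2 : |⟪z, u⟫_ℝ - ⟪z', u⟫_ℝ| ≤ ‖z - z'‖ := by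
    rw [← inner_sub_left]
    exact (abs_real_inner_le_norm _ _).trans (by rw [hu, mul_one])
  rw [Real.dist_eq] at h1 ⊢
  rw [dist_eq_norm, NNReal.coe_add, NNReal.coe_one, height, height]
  calc |⟪z, u⟫_ℝ - γ (proj u z) - (⟪z', u⟫_ℝ - γ (proj u z'))|
      = |(⟪z, u⟫_ℝ - ⟪z', u⟫_ℝ) - (γ (proj u z) - γ (proj u z'))| := by ring_nf
    _ ≤ |⟪z, u⟫_ℝ - ⟪z', u⟫_ℝ| + |γ (proj u z) - γ (proj u z')| := abs_sub _ _
    _ ≤ ‖z - z'‖ + M * ‖z - z'‖ := add_le_add h2 h1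
    _ = (M + 1) * ‖z - z'‖ := by ring

/-- The special Lipschitz domain `{γ (y - ⟪y, u⟫ u) < ⟪y, u⟫}` is `{0 < height u γ}`.
[folklore] -/
theorem setOf_height_pos (u : E') (γ : E' → ℝ) :
    {z | 0 < height u γ z} = {y | γ (y - ⟪y, u⟫_ℝ • u) < ⟪y, u⟫_ℝ} := by
  ext z; simp [height, proj, sub_pos]

end LipGraph

/-! ### One-dimensional change of variables and the averaging inequality -/

section OneDim

/-- Affine change of variables on `ℝ` for the lower Lebesgue integral:
`∫ G(a s + c) ds = |a⁻¹| ∫ G` for `a ≠ 0`, for *every* `G : ℝ → [0, ∞]` (no measurability).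
The tree has the measurable, unshifted or `n`-dimensional forms `Literature.Analysis.FunctionSpaces.lintegral_comp_smul_add`
(`SobolevTracePoincareProofs`, `Measurable H`, a Haar measure on `E`) and
`lintegral_comp_mul_left_eq` (`FluidPDE/NSViscosityRescaling`, no shift); this two-line variant
(Mathlib's `Real.map_volume_mul_left`, `lintegral_map_equiv`, `lintegral_add_right_eq_self`) is
kept here so that this file depends on neither. [folklore] -/
theorem lintegral_comp_mul_add (G : ℝ → ℝ≥0∞) {a : ℝ} (ha : a ≠ 0) (c : ℝ) :
    ∫⁻ s, G (a * s + c) = ENNReal.ofReal |a⁻¹| * ∫⁻ t, G t := by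
  have h1 : ∫⁻ s, G (a * s + c) = ∫⁻ t, G (t + c) ∂(Measure.map (fun s => a * s) volume) := by
    rw [show (fun s => a * s) = ⇑(Homeomorph.mulLeft₀ a ha).toMeasurableEquiv from rfl,
      lintegral_map_equiv]
    rfl
  rw [h1, Real.map_volume_mul_left ha, lintegral_smul_measure, smul_eq_mul,
    lintegral_add_right_eq_self (μ := (volume : Measure ℝ)) G c]

/-- **The averaging inequality on a line** (the substitute for Hardy's inequality, Stein,
Appendix A.4, in the proof of Ch. VI, Theorem 5', (27)–(28)): for measurable `V ≥ 0` on `ℝ`,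
`y₀ ∈ ℝ` and `a ≥ 2`,
`∫_{y < y₀} ∫_{σ ∈ (2, a]} V(y + σ (y₀ - y)) dσ dy ≤ (a - 2) ∫_{y > y₀} V(y) dy`:
for fixed `σ ≥ 2` the substitution `h = y + σ (y₀ - y)` (slope `1 - σ ≤ -1`) maps `{y < y₀}`
onto `{h > y₀}` and `∫_{y < y₀} V(y + σ(y₀ - y)) dy = (σ - 1)⁻¹ ∫_{h > y₀} V(h) dh`.
[cite: SteinSingularIntegrals1970, Ch. VI §3.2.3 (27)–(28) and Appendix A.4] -/
theorem setLIntegral_Iio_lintegral_Ioc_le {V : ℝ → ℝ≥0∞} (hV : Measurable V) (y₀ : ℝ) (a : ℝ) :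
    ∫⁻ y in Iio y₀, ∫⁻ σ in Ioc 2 a, V (y + σ * (y₀ - y)) ≤
      ENNReal.ofReal (a - 2) * ∫⁻ h in Ioi y₀, V h := by
  -- swap the integrals
  have hmeas : Measurable (uncurry fun (y σ : ℝ) => V (y + σ * (y₀ - y))) :=
    hV.comp (measurable_fst.add (measurable_snd.mul (measurable_const.sub measurable_fst)))
  rw [lintegral_lintegral_swap (hmeas.aemeasurable)]
  -- bound the inner integral for each `σ ∈ (2, a]`
  have hinner : ∀ σ ∈ Ioc (2 : ℝ) a,
      ∫⁻ y in Iio y₀, V (y + σ * (y₀ - y)) ≤ ∫⁻ h in Ioi y₀, V h := fun σ hσ => by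
    have hσ1 : (0 : ℝ) < σ - 1 := by linarith [hσ.1]
    have h1σ : (1 : ℝ) - σ ≠ 0 := by linarith [hσ.1]
    rw [← lintegral_indicator measurableSet_Iio, ← lintegral_indicator measurableSet_Ioi]
    have hind : (fun y => (Iio y₀).indicator (fun y => V (y + σ * (y₀ - y))) y) =
        fun y => (Ioi y₀).indicator V ((1 - σ) * y + σ * y₀) := by
      funext y
      have e : y + σ * (y₀ - y) = (1 - σ) * y + σ * y₀ := by ring
      by_cases hy : y ∈ Iio y₀
      · rw [indicator_of_mem hy, e, indicator_of_mem]
        rw [mem_Ioi]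
        have : 0 < (σ - 1) * (y₀ - y) := mul_pos hσ1 (sub_pos.2 hy)
        nlinarith
      · rw [indicator_of_notMem hy, indicator_of_notMem]
        rw [mem_Ioi, not_lt]
        have : (σ - 1) * (y₀ - y) ≤ 0 := mul_nonpos_of_nonneg_of_nonpos hσ1.le (by
          rw [mem_Iio, not_lt] at hy; linarith)
        nlinarith
    rw [hind, lintegral_comp_mul_add _ h1σ]
    have habs : ENNReal.ofReal |(1 - σ)⁻¹| ≤ 1 := by
      rw [abs_inv, show |1 - σ| = σ - 1 by rw [abs_sub_comm]; exact abs_of_pos hσ1]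
      refine ENNReal.ofReal_le_one.2 (inv_le_one_of_one_le₀ (by linarith [hσ.1]))
    calc ENNReal.ofReal |(1 - σ)⁻¹| * ∫⁻ t, (Ioi y₀).indicator V t
        ≤ 1 * ∫⁻ t, (Ioi y₀).indicator V t := mul_le_mul_left habs _
      _ = ∫⁻ t, (Ioi y₀).indicator V t := one_mul _
  calc ∫⁻ σ in Ioc 2 a, ∫⁻ y in Iio y₀, V (y + σ * (y₀ - y))
      ≤ ∫⁻ σ in Ioc 2 a, ∫⁻ h in Ioi y₀, V h := setLIntegral_mono' measurableSet_Ioc hinner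
    _ = ENNReal.ofReal (a - 2) * ∫⁻ h in Ioi y₀, V h := by
        rw [setLIntegral_const, Real.volume_Ioc, mul_comm]

end OneDim

/-! ### The averaging inequality below a Lipschitz graph -/

section Graph

variable {E' : Type*} [NormedAddCommGroup E'] [InnerProductSpace ℝ E'] [FiniteDimensional ℝ E']
  [MeasurableSpace E'] [BorelSpace E']

/-- **Vertical slicing of an additive Haar measure**: `∫ Φ dμ = c⁻¹ ∫_{uᗮ} ∫_ℝ Φ(x + t u) dt dμH`,
`c = LipGraph.sliceConst hu μ` — the case `γ = 0` of the slicing formula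
`LipGraph.lintegral_hypMeasure_lintegral_line` (`SobolevTraceGraph`), solved for `∫ Φ dμ`.
[folklore] -/
theorem lintegral_eq_sliceConst_inv_mul {u : E'} (hu : ‖u‖ = 1) (μ : Measure E')
    [μ.IsAddHaarMeasure] {Φ : E' → ℝ≥0∞} (hΦ : Measurable Φ) :
    ∫⁻ z, Φ z ∂μ = (LipGraph.sliceConst hu μ : ℝ≥0∞)⁻¹ *
      ∫⁻ x, (∫⁻ t : ℝ, Φ (x + t • u)) ∂(LipGraph.hypMeasure u) := by
  have hc0 : (LipGraph.sliceConst hu μ : ℝ≥0∞) ≠ 0 :=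
    ENNReal.coe_ne_zero.2 (LipGraph.sliceConst_pos hu μ).ne'
  have h := LipGraph.lintegral_hypMeasure_lintegral_line hu μ (γ := fun _ => (0 : ℝ))
    measurable_const hΦ
  simp only [zero_add] at h
  rw [h, ← mul_assoc, ENNReal.inv_mul_cancel hc0 ENNReal.coe_ne_top, one_mul]

/-- **The graph is a null set**: for a continuous depth `d` with the flow property
`d (z + t u) = d z - t`, `μ {d = 0} = 0` (each vertical line `x + ℝ u` meets `{d = 0}` in the
single point `t = d x`; vertical slicing of `μ`). [folklore] -/
theorem measure_setOf_depth_eq_zero {u : E'} (hu : ‖u‖ = 1) {d : E' → ℝ} (hdc : Continuous d)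
    (hflow : ∀ z t, d (z + t • u) = d z - t) (μ : Measure E') [μ.IsAddHaarMeasure] :
    μ {z | d z = 0} = 0 := by
  have hm : MeasurableSet {z | d z = 0} := (isClosed_eq hdc continuous_const).measurableSet
  rw [← lintegral_indicator_one hm, lintegral_eq_sliceConst_inv_mul hu μ
    (Φ := {z | d z = 0}.indicator 1) ((measurable_const).indicator hm)]
  have hline : ∀ x : E', ∫⁻ t : ℝ, ({z | d z = 0}.indicator 1) (x + t • u) = 0 := by
    intro x
    have e : (fun t : ℝ => ({z | d z = 0}.indicator (1 : E' → ℝ≥0∞)) (x + t • u)) =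
        ({d x} : Set ℝ).indicator 1 := by
      funext t
      simp only [indicator, mem_setOf_eq, hflow, sub_eq_zero, mem_singleton_iff, Pi.one_apply,
        eq_comm]
    rw [e, lintegral_indicator_one (measurableSet_singleton _), Real.volume_singleton]
  simp only [hline, lintegral_zero, mul_zero]

/-- **Vertical averages below the graph are controlled by the values above it** (the
`L¹`-in-measure core of Stein, Ch. VI, §3.2.3, (27)–(28)): for a unit vector `u`, a continuous
depth `d` with `d (z + t u) = d z - t`, a measurable `V ≥ 0` and `a ≥ 2`,
`∫_{d > 0} ∫_{σ ∈ (2, a]} V(z + σ d(z) u) dσ dμ(z) ≤ (a - 2) ∫_{d < 0} V dμ`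
(slice along the lines `x + ℝ u` and apply `setLIntegral_Iio_lintegral_Ioc_le` on each line).
[cite: SteinSingularIntegrals1970, Ch. VI §3.2.3 (27)–(28)] -/
theorem setLIntegral_lineAvg_le {u : E'} (hu : ‖u‖ = 1) {d : E' → ℝ} (hdc : Continuous d)
    (hflow : ∀ z t, d (z + t • u) = d z - t) (μ : Measure E') [μ.IsAddHaarMeasure]
    {V : E' → ℝ≥0∞} (hV : Measurable V) (a : ℝ) :
    ∫⁻ z in {z | 0 < d z}, (∫⁻ σ in Ioc 2 a, V (z + (σ * d z) • u)) ∂μ ≤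
      ENNReal.ofReal (a - 2) * ∫⁻ z in {z | d z < 0}, V z ∂μ := by
  have hUm : MeasurableSet {z | 0 < d z} := (isOpen_lt continuous_const hdc).measurableSet
  have hΩm : MeasurableSet {z | d z < 0} := (isOpen_lt hdc continuous_const).measurableSet
  set c : ℝ≥0∞ := (LipGraph.sliceConst hu μ : ℝ≥0∞)⁻¹ with hc
  -- the two integrands, extended by zero
  set A : E' → ℝ≥0∞ := fun z => ∫⁻ σ in Ioc 2 a, V (z + (σ * d z) • u) with hA
  have hpath : Measurable fun q : E' × ℝ => q.1 + (q.2 * d q.1) • u :=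
    (continuous_fst.add ((continuous_snd.mul (hdc.comp continuous_fst)).smul
      continuous_const)).measurable
  have hAm : Measurable A := (hV.comp hpath).lintegral_prod_right'
  rw [← lintegral_indicator hUm, ← lintegral_indicator hΩm,
    lintegral_eq_sliceConst_inv_mul hu μ (hAm.indicator hUm),
    lintegral_eq_sliceConst_inv_mul hu μ (hV.indicator hΩm), ← mul_assoc,
    mul_comm (ENNReal.ofReal _) c, mul_assoc]
  refine mul_le_mul_right ?_ c
  rw [← lintegral_const_mul' _ _ ENNReal.ofReal_ne_top]
  refine lintegral_mono fun x => ?_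
  -- on the line `x + ℝ u`: depth `d (x + y u) = d x - y`
  set y₀ : ℝ := d x with hy₀
  have hline : ∀ y : ℝ, d (x + y • u) = y₀ - y := fun y => hflow x y
  set Vx : ℝ → ℝ≥0∞ := fun y => V (x + y • u) with hVx
  have hVxm : Measurable Vx :=
    hV.comp (continuous_const.add (continuous_id.smul continuous_const)).measurable
  have h1 : (fun y : ℝ => ({z | 0 < d z}.indicator A) (x + y • u)) =
      fun y => (Iio y₀).indicator (fun y => ∫⁻ σ in Ioc 2 a, Vx (y + σ * (y₀ - y))) y := by
    funext y
    by_cases hy : y < y₀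
    · have hmem : x + y • u ∈ {z | 0 < d z} := by
        change 0 < d (x + y • u); rw [hline]; linarith
      rw [indicator_of_mem hmem, indicator_of_mem (mem_Iio.2 hy), hA]
      simp only [hline, hVx]
      congr 1 with σ
      rw [add_assoc, ← add_smul]
    · have hnmem : x + y • u ∉ {z | 0 < d z} := by
        change ¬ 0 < d (x + y • u); rw [hline]; linarith
      rw [indicator_of_notMem hnmem, indicator_of_notMem (by rwa [mem_Iio])]
  have h2 : (fun y : ℝ => ({z | d z < 0}.indicator V) (x + y • u)) =
      fun y => (Ioi y₀).indicator Vx y := by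
    funext y
    by_cases hy : y₀ < y
    · have hmem : x + y • u ∈ {z | d z < 0} := by
        change d (x + y • u) < 0; rw [hline]; linarith
      rw [indicator_of_mem hmem, indicator_of_mem (mem_Ioi.2 hy)]
    · have hnmem : x + y • u ∉ {z | d z < 0} := by
        change ¬ d (x + y • u) < 0; rw [hline]; linarith
      rw [indicator_of_notMem hnmem, indicator_of_notMem (by rwa [mem_Ioi])]
  rw [h1, h2, lintegral_indicator measurableSet_Iio, lintegral_indicator measurableSet_Ioi]
  exact setLIntegral_Iio_lintegral_Ioc_le hVxm y₀ a

variable {F : Type*} [NormedAddCommGroup F]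

/-- Jensen's inequality on an interval: `(∫_{(2,a]} f)^q ≤ (a - 2)^{q-1} ∫_{(2,a]} f^q`, in the
form `(∫ f)^q ≤ (a-2)^q (a-2)⁻¹ ∫ f^q`, `1 ≤ q`, `2 < a`. [folklore] -/
theorem rpow_setLIntegral_Ioc_le {f : ℝ → ℝ≥0∞} (hf : Measurable f) {a : ℝ} (ha : 2 < a) {q : ℝ}
    (hq : 1 ≤ q) :
    (∫⁻ σ in Ioc 2 a, f σ) ^ q ≤
      ENNReal.ofReal (a - 2) ^ q * ((ENNReal.ofReal (a - 2))⁻¹ * ∫⁻ σ in Ioc 2 a, f σ ^ q) := by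
  set L : ℝ≥0∞ := ENNReal.ofReal (a - 2) with hL
  have hL0 : L ≠ 0 := by rw [hL]; exact (ENNReal.ofReal_pos.2 (by linarith)).ne'
  have hLT : L ≠ ⊤ := ENNReal.ofReal_ne_top
  have hvol : (volume : Measure ℝ) (Ioc 2 a) = L := by rw [Real.volume_Ioc]
  set ν : Measure ℝ := L⁻¹ • volume.restrict (Ioc 2 a) with hν
  haveI : IsProbabilityMeasure ν := ⟨by
    rw [hν, Measure.smul_apply, Measure.restrict_apply_univ, hvol, smul_eq_mul,
      ENNReal.inv_mul_cancel hL0 hLT]⟩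
  have hJ := rpow_lintegral_le_lintegral_rpow (ν := ν) (hf.aemeasurable) hq
  rw [hν, lintegral_smul_measure, lintegral_smul_measure, smul_eq_mul, smul_eq_mul] at hJ
  have hq0 : 0 ≤ q := zero_le_one.trans hq
  calc (∫⁻ σ in Ioc 2 a, f σ) ^ q = (L * (L⁻¹ * ∫⁻ σ in Ioc 2 a, f σ)) ^ q := by
        rw [← mul_assoc, ENNReal.mul_inv_cancel hL0 hLT, one_mul]
    _ = L ^ q * (L⁻¹ * ∫⁻ σ in Ioc 2 a, f σ) ^ q := ENNReal.mul_rpow_of_nonneg _ _ hq0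
    _ ≤ L ^ q * (L⁻¹ * ∫⁻ σ in Ioc 2 a, f σ ^ q) := mul_le_mul_right hJ _

omit [FiniteDimensional ℝ E'] [MeasurableSpace E'] [BorelSpace E'] in
/-- The vertical norm averages `z ↦ ∫₂^a ‖H(z + σ d(z) u)‖ dσ` of a continuous `H` are
continuous for a continuous depth `d` (a parametric integral of a jointly continuous
integrand). [folklore] -/
theorem continuous_lineNormAvg {u : E'} {d : E' → ℝ} (hdc : Continuous d) {H : E' → F}
    (hH : Continuous H) (a : ℝ) :
    Continuous fun z => ∫ σ in (2 : ℝ)..a, ‖H (z + (σ * d z) • u)‖ := by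
  refine intervalIntegral.continuous_parametric_intervalIntegral_of_continuous' ?_ 2 a
  exact (hH.comp (continuous_fst.add ((continuous_snd.mul (hdc.comp continuous_fst)).smul
    continuous_const))).norm

/-- **`L^p` bound for the vertical averages** (Stein, Ch. VI, §3.2.3, the passage from the
pointwise estimate to `‖D^α 𝔈(f)‖_{L^p} ≤ A ‖f‖_{L^p_k(D)}`, with constant uniform in `p`): for a
continuous `H`, a continuous depth `d` with `d (z + t u) = d z - t`, `1 ≤ p < ∞` and `a > 2`,
`‖z ↦ ∫₂^a ‖H(z + σ d(z) u)‖ dσ‖_{L^p({d > 0})} ≤ (a - 2) ‖H‖_{L^p({d < 0})}` (Jensen on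
`(2, a]`, then `setLIntegral_lineAvg_le` with `V = ‖H‖ₑ^p`). [cite: SteinSingularIntegrals1970, Ch. VI §3.2.3 (L^p bound from (27)–(28))] -/
theorem eLpNorm_lineNormAvg_le [NormedSpace ℝ F] {u : E'} (hu : ‖u‖ = 1) {d : E' → ℝ}
    (hdc : Continuous d) (hflow : ∀ z t, d (z + t • u) = d z - t) (μ : Measure E')
    [μ.IsAddHaarMeasure] {H : E' → F} (hH : Continuous H) {a : ℝ} (ha : 2 < a) {p : ℝ≥0∞}
    (hp : 1 ≤ p) (hpT : p ≠ ⊤) :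
    eLpNorm (fun z => ∫ σ in (2 : ℝ)..a, ‖H (z + (σ * d z) • u)‖) p
        (μ.restrict {z | 0 < d z}) ≤
      ENNReal.ofReal (a - 2) * eLpNorm H p (μ.restrict {z | d z < 0}) := by
  have hUm : MeasurableSet {z | 0 < d z} := (isOpen_lt continuous_const hdc).measurableSet
  have hp0 : p ≠ 0 := (lt_of_lt_of_le one_pos hp).ne'
  set q : ℝ := p.toReal with hq
  have hq1 : 1 ≤ q := by
    rw [hq, ← ENNReal.toReal_one]; exact (ENNReal.toReal_le_toReal ENNReal.one_ne_top hpT).2 hp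
  have hq0 : 0 < q := one_pos.trans_le hq1
  set L : ℝ≥0∞ := ENNReal.ofReal (a - 2) with hL
  have hL0 : L ≠ 0 := by rw [hL]; exact (ENNReal.ofReal_pos.2 (by linarith)).ne'
  have hLT : L ≠ ⊤ := ENNReal.ofReal_ne_top
  rw [eLpNorm_eq_lintegral_rpow_enorm_toReal hp0 hpT, eLpNorm_eq_lintegral_rpow_enorm_toReal hp0 hpT]
  -- pointwise: the `enorm` of the average is the `lintegral` of `‖H‖ₑ` over `(2, a]`
  have hpath : ∀ z, Continuous fun σ : ℝ => H (z + (σ * d z) • u) := fun z =>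
    hH.comp (continuous_const.add ((continuous_id.mul continuous_const).smul continuous_const))
  have hpt : ∀ z, ‖∫ σ in (2 : ℝ)..a, ‖H (z + (σ * d z) • u)‖‖ₑ =
      ∫⁻ σ in Ioc 2 a, ‖H (z + (σ * d z) • u)‖ₑ := fun z => by
    rw [intervalIntegral.integral_of_le ha.le, Real.enorm_eq_ofReal
      (integral_nonneg fun σ => norm_nonneg _), ofReal_integral_norm_eq_lintegral_enorm]
    exact ((hpath z).integrableOn_Icc (a := 2) (b := a)).mono_set Ioc_subset_Icc_self
  simp_rw [hpt]
  -- Jensen, then the averaging inequality with `V = ‖H‖ₑ ^ q`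
  have hmeasσ : ∀ z, Measurable fun σ : ℝ => ‖H (z + (σ * d z) • u)‖ₑ := fun z =>
    (hpath z).enorm.measurable
  have hV : Measurable fun z => ‖H z‖ₑ ^ q := hH.enorm.measurable.pow_const q
  have hmain := setLIntegral_lineAvg_le hu hdc hflow μ hV a
  calc (∫⁻ z in {z | 0 < d z}, (∫⁻ σ in Ioc 2 a, ‖H (z + (σ * d z) • u)‖ₑ) ^ q ∂μ) ^ (1 / q)
      ≤ (∫⁻ z in {z | 0 < d z}, L ^ q * (L⁻¹ * ∫⁻ σ in Ioc 2 a, ‖H (z + (σ * d z) • u)‖ₑ ^ q) ∂μ) ^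
          (1 / q) := by
        gcongr with z
        exact rpow_setLIntegral_Ioc_le (hmeasσ z) ha hq1
    _ = (L ^ q * (L⁻¹ * ∫⁻ z in {z | 0 < d z}, (∫⁻ σ in Ioc 2 a, ‖H (z + (σ * d z) • u)‖ₑ ^ q) ∂μ)) ^
          (1 / q) := by
        rw [lintegral_const_mul' _ _ (ENNReal.rpow_ne_top_of_nonneg hq0.le hLT),
          lintegral_const_mul' _ _ (ENNReal.inv_ne_top.2 hL0)]
    _ ≤ (L ^ q * (L⁻¹ * (L * ∫⁻ z in {z | d z < 0}, ‖H z‖ₑ ^ q ∂μ))) ^ (1 / q) := by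
        gcongr
    _ = (L ^ q * ∫⁻ z in {z | d z < 0}, ‖H z‖ₑ ^ q ∂μ) ^ (1 / q) := by
        rw [← mul_assoc L⁻¹, ENNReal.inv_mul_cancel hL0 hLT, one_mul]
    _ = L * (∫⁻ z in {z | d z < 0}, ‖H z‖ₑ ^ q ∂μ) ^ (1 / q) := by
        rw [ENNReal.mul_rpow_of_nonneg _ _ (by positivity), ← ENNReal.rpow_mul,
          show q * (1 / q) = 1 by field_simp, ENNReal.rpow_one]

end Graph

end Literature.Analysis.FunctionSpaces
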